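import Mathlib.NumberTheory.Real.GoldenRatio
import Mathlib.Analysis.SpecialFunctions.Complex.Analytic
import Mathlib.Analysis.SpecialFunctions.Pow.Deriv
import Mathlib.Analysis.SpecialFunctions.Pow.Real
import Mathlib.Analysis.Analytic.IsolatedZeros
import Mathlib.Analysis.SpecialFunctions.Log.Basic
import Mathlib.Data.Nat.Log
import Mathlib.Algebra.MvPolynomial.Basic
import Mathlib.SetTheory.Cardinal.Finite
import HarnessLib

/-!
# The golden (Pell) germ: an algebraic cusp tail with integer hits of positive logarithmic density

Integer points on the graph of a function analytic at infinity,
`h(N) = A(N^{1/e}) + g(N^{-1/e})` (`A` a polynomial "jet", `g` an analytic "tail" at `0` with `g 0 = 0`),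
are the arithmetic end of several counting problems (Runge's method; Pólya/Schneider-type sparsity
statements for TRANSCENDENTAL tails, e.g. "the hits `{N : h(N) ∈ ℤ}` have zero lower logarithmic
density"). This file records, in exactly that format, the classical extremal ALGEBRAIC example:

* `goldenGerm σ = (√(5 + 4σ²) − √5)/(2σ)` (`goldenGerm 0 = 0`): analytic at `0`
  (`analyticAt_goldenGerm`), algebraic (`goldenGerm_algebraic`: `σ·g² + √5·g − σ = 0`), not
  identically zero near `0` (`goldenGerm_not_eventually_zero`);
* with the real, irrational jet `A = φ·X` (`φ` the golden ratio) and `e = 1`, every even-indexed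
  Fibonacci number is a hit: `φ·F₂ₙ + goldenGerm(1/F₂ₙ) = F₂ₙ₊₁` (`goldenGerm_inv_fib`, Binet), so the
  hit set has POSITIVE LOWER LOGARITHMIC DENSITY: `#{N ≤ X hit} ≥ ⌊log₃ X⌋` (`log_le_card_goldenHits`,
  from `F₂ₙ ≤ 3ⁿ`) and eventually `> log X/(2 log 3)` (`eventually_log_lt_card_goldenHits`).

Consequently a zero-log-density statement for cusp hits is FALSE without a transcendence hypothesis on
the tail, even for irrational real jets with a non-zero tail (`not_zeroLogDensity_goldenGerm`), and the
`log X` scale of such statements is attained by algebraic tails (Pell conics carry `≍ log X` integer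
points) — the statement is sharp at that scale.

The construction of `goldenGerm` via `dslope` and the Binet evaluation are adapted from the crux
work-file `Summits/Schanuel/Schanuel/Cruxes/SparsityTwo/PellTightness.lean` (refuter-drefute, 2026-08-16);
the density count is new here. Everything is elementary (Binet's formula, `F₂ₙ ≤ 3ⁿ`); folklore.
Not here: the transcendental case (a theorem-shape of Surroca 2002 / Schneider's method), Pell
equations for general `d`.
-/

namespace Literature.NumberTheory.Transcendental

open Filter Complex Polynomial Real
open _root_.Topology
open scoped goldenRatio

noncomputable section

/-! ## The germ -/

/-- Auxiliary: `σ ↦ (5 + 4σ²)^{1/2} − √5` (principal branch; `5 + 4σ²` lies in the slit plane near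
`0`). [folklore] -/
def goldenAux : ℂ → ℂ := fun σ => ((5 : ℂ) + 4 * σ ^ 2) ^ ((2 : ℂ)⁻¹) - ((Real.sqrt 5 : ℝ) : ℂ)

/-- The golden (Pell) germ `g(σ) = (√(5 + 4σ²) − √5)/(2σ)`, extended by `g 0 = 0`; built as half the
`dslope` of `goldenAux` at `0`. [folklore] -/
def goldenGerm : ℂ → ℂ := fun σ => dslope goldenAux 0 σ / 2

/-- `goldenAux` is analytic at `0`. [folklore] -/
theorem analyticAt_goldenAux : AnalyticAt ℂ goldenAux 0 := by
  have h1 : AnalyticAt ℂ (fun σ : ℂ => (5 : ℂ) + 4 * σ ^ 2) 0 :=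
    analyticAt_const.add (analyticAt_const.mul (analyticAt_id.pow 2))
  have h2 : AnalyticAt ℂ (fun σ : ℂ => ((5 : ℂ) + 4 * σ ^ 2) ^ ((2 : ℂ)⁻¹)) 0 := by
    refine h1.cpow analyticAt_const ?_
    have : (5 : ℂ) + 4 * (0 : ℂ) ^ 2 = ((5 : ℝ) : ℂ) := by push_cast; ring
    simp only [this, Complex.ofReal_mem_slitPlane]
    norm_num
  exact h2.sub analyticAt_const

/-- `goldenAux 0 = 0`. [folklore] -/
theorem goldenAux_zero : goldenAux 0 = 0 := by
  have h5 : (5 : ℂ) + 4 * (0 : ℂ) ^ 2 = ((5 : ℝ) : ℂ) := by push_cast; ring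
  have h2 : ((2 : ℂ)⁻¹) = (((2 : ℝ)⁻¹ : ℝ) : ℂ) := by push_cast; ring
  simp only [goldenAux, h5, h2, ← Complex.ofReal_cpow (by norm_num : (0 : ℝ) ≤ 5)]
  rw [← one_div, ← Real.sqrt_eq_rpow]
  simp

/-- `goldenAux` has derivative `0` at `0`. [folklore] -/
theorem hasDerivAt_goldenAux_zero : HasDerivAt goldenAux 0 0 := by
  have h1 : HasDerivAt (fun σ : ℂ => (5 : ℂ) + 4 * σ ^ 2) (4 * ((2 : ℕ) * (0 : ℂ) ^ (2 - 1))) 0 :=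
    ((hasDerivAt_pow 2 (0 : ℂ)).const_mul 4).const_add 5
  have hmem : (fun σ : ℂ => (5 : ℂ) + 4 * σ ^ 2) 0 ∈ slitPlane := by
    have : (5 : ℂ) + 4 * (0 : ℂ) ^ 2 = ((5 : ℝ) : ℂ) := by push_cast; ring
    simp only [this, Complex.ofReal_mem_slitPlane]
    norm_num
  have h2 := (h1.cpow_const (c := (2 : ℂ)⁻¹) hmem).sub_const (((Real.sqrt 5 : ℝ) : ℂ))
  simp only [Nat.cast_ofNat, pow_one, mul_zero, Nat.add_one_sub_one] at h2
  exact h2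

/-- `goldenGerm 0 = 0`. [folklore] -/
theorem goldenGerm_zero : goldenGerm 0 = 0 := by
  simp [goldenGerm, dslope_same, hasDerivAt_goldenAux_zero.deriv]

/-- The golden germ is analytic at `0`. [folklore] -/
theorem analyticAt_goldenGerm : AnalyticAt ℂ goldenGerm 0 := by
  obtain ⟨p, hp⟩ := analyticAt_goldenAux
  have h : AnalyticAt ℂ (dslope goldenAux 0) 0 := ⟨_, hp.has_fpower_series_dslope_fslope⟩
  exact h.div analyticAt_const two_ne_zero

/-- Off the origin, `2σ·goldenGerm σ = goldenAux σ`. [folklore] -/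
theorem two_mul_mul_goldenGerm {σ : ℂ} (hσ : σ ≠ 0) : 2 * σ * goldenGerm σ = goldenAux σ := by
  simp only [goldenGerm, dslope_of_ne _ hσ, slope_def_field, goldenAux_zero, sub_zero]
  field_simp

/-- **The golden germ is algebraic**: `σ·g(σ)² + √5·g(σ) − σ = 0` for every `σ`, i.e. the non-zero
polynomial `X₀X₁² + √5·X₁ − X₀` vanishes on its graph (so it is no counterexample to statements
about TRANSCENDENTAL tails). [folklore] -/
theorem goldenGerm_algebraic :
    ∃ P : MvPolynomial (Fin 2) ℂ, P ≠ 0 ∧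
      ∀ᶠ z in 𝓝 (0 : ℂ), MvPolynomial.eval ![z, goldenGerm z] P = 0 := by
  refine ⟨MvPolynomial.X 0 * MvPolynomial.X 1 ^ 2 +
      MvPolynomial.C ((Real.sqrt 5 : ℝ) : ℂ) * MvPolynomial.X 1 - MvPolynomial.X 0, ?_, ?_⟩
  · intro h
    have := congrArg (MvPolynomial.eval ![(1 : ℂ), 1]) h
    simp only [map_sub, map_add, map_mul, map_pow, MvPolynomial.eval_X, MvPolynomial.eval_C,
      Matrix.cons_val_zero, Matrix.cons_val_one, Matrix.cons_val_fin_one,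
      map_zero, mul_one, one_pow] at this
    have h5 : (0 : ℝ) < Real.sqrt 5 := Real.sqrt_pos.mpr (by norm_num)
    have : ((Real.sqrt 5 : ℝ) : ℂ) = 0 := by linear_combination this
    exact h5.ne' (by exact_mod_cast this)
  · refine Filter.Eventually.of_forall fun z => ?_
    simp only [map_sub, map_add, map_mul, map_pow, MvPolynomial.eval_X, MvPolynomial.eval_C,
      Matrix.cons_val_zero, Matrix.cons_val_one, Matrix.cons_val_fin_one]
    rcases eq_or_ne z 0 with rfl | hz
    · simp [goldenGerm_zero]
    · have hsq : (((5 : ℂ) + 4 * z ^ 2) ^ ((2 : ℂ)⁻¹)) ^ 2 = (5 : ℂ) + 4 * z ^ 2 := by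
        rw [show ((2 : ℂ)⁻¹) = ((2 : ℕ) : ℂ)⁻¹ by norm_num]
        exact Complex.cpow_nat_inv_pow _ two_ne_zero
      have h5 : (((Real.sqrt 5 : ℝ) : ℂ)) ^ 2 = 5 := by
        rw [← Complex.ofReal_pow, Real.sq_sqrt (by norm_num : (0 : ℝ) ≤ 5)]
        push_cast
        ring
      have hg := two_mul_mul_goldenGerm hz
      -- `2zg = s − √5` with `s² = 5 + 4z²`; multiply the target by `4z ≠ 0`.
      have h4z : (4 : ℂ) * z ≠ 0 := mul_ne_zero (by norm_num) hz
      have key : (2 * z * goldenGerm z + ((Real.sqrt 5 : ℝ) : ℂ)) ^ 2 = (5 : ℂ) + 4 * z ^ 2 := by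
        rw [hg]
        simp only [goldenAux, sub_add_cancel]
        exact hsq
      have hprod : (4 : ℂ) * z *
          (z * goldenGerm z ^ 2 + ((Real.sqrt 5 : ℝ) : ℂ) * goldenGerm z - z) = 0 := by
        linear_combination key - h5
      exact (mul_eq_zero.mp hprod).resolve_left h4z

/-! ## Values at the even Fibonacci numbers -/

/-- On a real abscissa `goldenAux` is the real square root. [folklore] -/
theorem goldenAux_ofReal {s : ℝ} :
    goldenAux (s : ℂ) = ((Real.sqrt (5 + 4 * s ^ 2) - Real.sqrt 5 : ℝ) : ℂ) := by
  have hnn : (0 : ℝ) ≤ 5 + 4 * s ^ 2 := by positivity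
  have h5 : (5 : ℂ) + 4 * (s : ℂ) ^ 2 = ((5 + 4 * s ^ 2 : ℝ) : ℂ) := by push_cast; ring
  have h2 : ((2 : ℂ)⁻¹) = (((2 : ℝ)⁻¹ : ℝ) : ℂ) := by push_cast; ring
  simp only [goldenAux, h5, h2, ← Complex.ofReal_cpow hnn]
  rw [← one_div, ← Real.sqrt_eq_rpow]
  push_cast
  ring

/-- The Pell identity behind the germ: `√(5 + 4/F₂ₙ²) = 2ψ²ⁿ/F₂ₙ + √5` (`ψ = (1 − √5)/2`).
[folklore] -/
theorem sqrt_golden_identity (n : ℕ) (hn : 1 ≤ n) :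
    Real.sqrt (5 + 4 * ((Nat.fib (2 * n) : ℝ)⁻¹) ^ 2) =
      2 * (Nat.fib (2 * n) : ℝ)⁻¹ * ψ ^ (2 * n) + Real.sqrt 5 := by
  set F : ℝ := (Nat.fib (2 * n) : ℝ) with hFdef
  set P : ℝ := φ ^ (2 * n) with hPdef
  set Q : ℝ := ψ ^ (2 * n) with hQdef
  have hFpos : 0 < F := by
    rw [hFdef]; exact_mod_cast Nat.fib_pos.mpr (by omega)
  have hQnn : 0 ≤ Q := by rw [hQdef, pow_mul]; positivity
  have hPQ : P * Q = 1 := by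
    rw [hPdef, hQdef, ← mul_pow, goldenRatio_mul_goldenConj, pow_mul]; norm_num
  have h5 : Real.sqrt 5 * Real.sqrt 5 = 5 := Real.mul_self_sqrt (by norm_num)
  have hF : Real.sqrt 5 * F = P - Q := by
    rw [hFdef, Real.coe_fib_eq, hPdef, hQdef]
    field_simp
  have hσ : F⁻¹ * F = 1 := inv_mul_cancel₀ hFpos.ne'
  set s : ℝ := F⁻¹ with hsdef
  have hy : 0 ≤ 2 * s * Q + Real.sqrt 5 := by positivity
  rw [Real.sqrt_eq_iff_mul_self_eq (by positivity) hy]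
  linear_combination (-1 : ℝ) * h5 + (4 * Real.sqrt 5 * s * Q) * hσ + (-(4 * s ^ 2 * Q)) * hF +
    (-(4 * s ^ 2)) * hPQ

/-- Value of the golden germ at `1/F₂ₙ`: `goldenGerm (1/F₂ₙ) = ψ²ⁿ`. [folklore] -/
theorem goldenGerm_inv_fib (n : ℕ) (hn : 1 ≤ n) :
    goldenGerm ((Nat.fib (2 * n) : ℂ))⁻¹ = ((ψ ^ (2 * n) : ℝ) : ℂ) := by
  have hFpos : (0 : ℝ) < Nat.fib (2 * n) := by exact_mod_cast Nat.fib_pos.mpr (by omega)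
  have hcast : ((Nat.fib (2 * n) : ℂ))⁻¹ = (((Nat.fib (2 * n) : ℝ)⁻¹ : ℝ) : ℂ) := by push_cast; rfl
  have hne : (((Nat.fib (2 * n) : ℝ)⁻¹ : ℝ) : ℂ) ≠ 0 := by
    exact_mod_cast (inv_pos.mpr hFpos).ne'
  rw [hcast]
  simp only [goldenGerm, dslope_of_ne _ hne, slope_def_field, goldenAux_zero, sub_zero,
    goldenAux_ofReal, sqrt_golden_identity n hn]
  have hne' : ((Nat.fib (2 * n) : ℝ)⁻¹ : ℝ) ≠ 0 := (inv_pos.mpr hFpos).ne'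
  push_cast
  field_simp
  ring

/-- The golden germ is not identically zero near `0` (it equals `ψ²ⁿ ≠ 0` at `1/F₂ₙ → 0`).
[folklore] -/
theorem goldenGerm_not_eventually_zero : ¬ ∀ᶠ z in 𝓝 (0 : ℂ), goldenGerm z = 0 := by
  intro key
  obtain ⟨r, hr, hball⟩ := Metric.eventually_nhds_iff.mp key
  set M : ℕ := ⌈r⁻¹⌉₊ with hMdef
  have hM : r⁻¹ ≤ (M : ℝ) := Nat.le_ceil _
  have hfib : 2 * M ≤ Nat.fib (2 * M + 2) := Nat.fib_add_two_strictMono.id_le (2 * M)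
  have hn : 1 ≤ M + 1 := by omega
  have h2n : 2 * (M + 1) = 2 * M + 2 := by ring
  have hFpos : (0 : ℝ) < Nat.fib (2 * (M + 1)) := by exact_mod_cast Nat.fib_pos.mpr (by omega)
  have hbig : r⁻¹ < (Nat.fib (2 * (M + 1)) : ℝ) := by
    have h2 : 2 * M ≤ Nat.fib (2 * (M + 1)) := by rw [h2n]; exact hfib
    have h2' : (2 * M : ℝ) ≤ (Nat.fib (2 * (M + 1)) : ℝ) := by exact_mod_cast h2
    have hMpos : (0 : ℝ) < M := lt_of_lt_of_le (inv_pos.mpr hr) hM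
    linarith
  have hdist : dist (((Nat.fib (2 * (M + 1)) : ℂ))⁻¹) 0 < r := by
    rw [dist_zero_right, norm_inv, Complex.norm_natCast, inv_lt_comm₀ hFpos hr]
    exact hbig
  have hzero := hball hdist
  rw [goldenGerm_inv_fib (M + 1) hn] at hzero
  have hψ : (ψ ^ (2 * (M + 1)) : ℝ) ≠ 0 := pow_ne_zero _ goldenConj_ne_zero
  exact hψ (by exact_mod_cast hzero)

/-! ## The hits: every `F₂ₙ` (`n ≥ 1`) is an integer point of `φ·N + goldenGerm(1/N)` -/

/-- The cusp hit set in the standard format: `N` with `A(N^{1/e}) + g(N^{-1/e}) ∈ ℤ`. [folklore] -/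
def cuspHits (e : ℕ) (A : Polynomial ℂ) (g : ℂ → ℂ) : Set ℕ :=
  {N : ℕ | ∃ L : ℤ, A.eval ((((N : ℝ) ^ ((e : ℝ)⁻¹) : ℝ) : ℂ)) +
    g ((((N : ℝ) ^ ((e : ℝ)⁻¹) : ℝ) : ℂ))⁻¹ = L}

/-- The golden jet `A = φ·X ∈ ℂ[X]` (real, irrational leading coefficient). [folklore] -/
def goldenJet : Polynomial ℂ := Polynomial.C ((φ : ℝ) : ℂ) * Polynomial.X

/-- **Every even-indexed Fibonacci number is a hit**: `φ·F₂ₙ + goldenGerm(1/F₂ₙ) = F₂ₙ₊₁` (`n ≥ 1`;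
Binet: `F₂ₙ₊₁ − φF₂ₙ = ψ²ⁿ`). [folklore] -/
theorem fib_mem_cuspHits_golden (n : ℕ) (hn : 1 ≤ n) :
    Nat.fib (2 * n) ∈ cuspHits 1 goldenJet goldenGerm := by
  refine ⟨(Nat.fib (2 * n + 1) : ℤ), ?_⟩
  have hval := goldenGerm_inv_fib n hn
  have hbinet := Real.fib_succ_sub_goldenRatio_mul_fib (2 * n)
  have hbinetC := congrArg (fun x : ℝ => (x : ℂ)) hbinet
  push_cast at hbinetC
  simp only [goldenJet, Polynomial.eval_mul, Polynomial.eval_C, Polynomial.eval_X, Nat.cast_one,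
    inv_one, Real.rpow_one, Complex.ofReal_natCast]
  rw [hval]
  push_cast
  linear_combination (-1 : ℂ) * hbinetC

/-! ## Counting: `F₂ₙ ≤ 3ⁿ`, so `⌊log₃ X⌋` hits below `X` -/

/-- Two Fibonacci steps at most triple: `F_{m+4} ≤ 3·F_{m+2}`. [folklore] -/
theorem fib_add_four_le (m : ℕ) : Nat.fib (m + 4) ≤ 3 * Nat.fib (m + 2) := by
  have h1 : Nat.fib (m + 4) = Nat.fib (m + 2) + Nat.fib (m + 3) := Nat.fib_add_two
  have h2 : Nat.fib (m + 3) = Nat.fib (m + 1) + Nat.fib (m + 2) := Nat.fib_add_two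
  have h3 : Nat.fib (m + 1) ≤ Nat.fib (m + 2) := Nat.fib_le_fib_succ
  omega

/-- `F₂ₙ ≤ 3ⁿ`. [folklore] -/
theorem fib_two_mul_le_three_pow (n : ℕ) : Nat.fib (2 * n) ≤ 3 ^ n := by
  induction n with
  | zero => simp
  | succ n ih =>
    rcases Nat.eq_zero_or_pos n with rfl | hn
    · decide
    · obtain ⟨k, rfl⟩ := Nat.exists_eq_add_of_le hn
      -- n = 1 + k
      have h := fib_add_four_le (2 * k)
      have e1 : 2 * (1 + k + 1) = 2 * k + 4 := by ring
      have e2 : 2 * (1 + k) = 2 * k + 2 := by ring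
      rw [e1]
      rw [e2] at ih
      calc Nat.fib (2 * k + 4) ≤ 3 * Nat.fib (2 * k + 2) := h
        _ ≤ 3 * 3 ^ (1 + k) := Nat.mul_le_mul_left 3 ih
        _ = 3 ^ (1 + k + 1) := by ring

/-- `n ↦ F₂₍ₙ₊₁₎` is injective. [folklore] -/
theorem fib_two_mul_succ_injective : Function.Injective fun n : ℕ => Nat.fib (2 * (n + 1)) := by
  intro a b h
  have hsm := Nat.fib_add_two_strictMono
  have h' : Nat.fib (2 * a + 2) = Nat.fib (2 * b + 2) := by
    have ea : 2 * (a + 1) = 2 * a + 2 := by ring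
    have eb : 2 * (b + 1) = 2 * b + 2 := by ring
    simpa [ea, eb] using h
  have := hsm.injective h'
  omega

/-- The counted set `{N ≤ X : N a hit}` is finite. [folklore] -/
theorem finite_cuspHits_le (e : ℕ) (A : Polynomial ℂ) (g : ℂ → ℂ) (X : ℕ) :
    Set.Finite {N : ℕ | N ≤ X ∧ N ∈ cuspHits e A g} :=
  (Set.finite_Iic X).subset fun _ hN => hN.1

/-- **At least `⌊log₃ X⌋` golden hits below `X`** (the hits `F₂, F₄, …, F₂ₖ` with `3ᵏ ≤ X`).
[folklore] -/
theorem log_le_card_goldenHits (X : ℕ) (hX : X ≠ 0) :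
    Nat.log 3 X ≤ Nat.card {N : ℕ | N ≤ X ∧ N ∈ cuspHits 1 goldenJet goldenGerm} := by
  set K := Nat.log 3 X with hK
  set S := {N : ℕ | N ≤ X ∧ N ∈ cuspHits 1 goldenJet goldenGerm} with hS
  haveI : Finite S := (finite_cuspHits_le 1 goldenJet goldenGerm X).to_subtype
  have h3K : 3 ^ K ≤ X := Nat.pow_log_le_self 3 hX
  let f : Fin K → S := fun i => ⟨Nat.fib (2 * ((i : ℕ) + 1)), by
    refine ⟨?_, fib_mem_cuspHits_golden ((i : ℕ) + 1) (by omega)⟩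
    calc Nat.fib (2 * ((i : ℕ) + 1)) ≤ 3 ^ ((i : ℕ) + 1) := fib_two_mul_le_three_pow _
      _ ≤ 3 ^ K := Nat.pow_le_pow_right (by norm_num) i.isLt
      _ ≤ X := h3K⟩
  have hf : Function.Injective f := by
    intro i j hij
    have h1 : Nat.fib (2 * ((i : ℕ) + 1)) = Nat.fib (2 * ((j : ℕ) + 1)) := by
      have := congrArg (fun x : S => (x : ℕ)) hij
      simpa [f] using this
    exact Fin.ext (fib_two_mul_succ_injective h1)
  have := Nat.card_le_card_of_injective f hf
  simpa using this

/-- **Positive lower logarithmic density of the golden hits**: eventually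
`log X/(2 log 3) < #{N ≤ X : φN + goldenGerm(1/N) ∈ ℤ}` (indeed for all `X ≥ 9`). [folklore] -/
theorem eventually_log_lt_card_goldenHits :
    ∀ᶠ X : ℕ in atTop, (1 / (2 * Real.log 3)) * Real.log X <
      (Nat.card {N : ℕ | N ≤ X ∧ N ∈ cuspHits 1 goldenJet goldenGerm} : ℝ) := by
  refine Filter.eventually_atTop.2 ⟨9, fun X hX => ?_⟩
  have hX0 : X ≠ 0 := by omega
  have hcard := log_le_card_goldenHits X hX0
  set K := Nat.log 3 X with hK
  have hlog3 : 0 < Real.log 3 := Real.log_pos (by norm_num)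
  -- `X < 3^(K+1)` gives `log X < (K+1) log 3`.
  have hlt : X < 3 ^ (K + 1) := Nat.lt_pow_succ_log_self (by norm_num) X
  have hXpos : (0 : ℝ) < X := by exact_mod_cast Nat.pos_of_ne_zero hX0
  have hlt' : Real.log X < (K + 1 : ℝ) * Real.log 3 := by
    have h1 : (X : ℝ) < (3 : ℝ) ^ (K + 1) := by exact_mod_cast hlt
    have h2 := Real.log_lt_log hXpos h1
    rwa [Real.log_pow, Nat.cast_add, Nat.cast_one] at h2
  -- `9 ≤ X` gives `2 log 3 ≤ log X`.
  have hge : 2 * Real.log 3 ≤ Real.log X := by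
    have h9 : (9 : ℝ) ≤ X := by exact_mod_cast hX
    have : Real.log 9 ≤ Real.log X := Real.log_le_log (by norm_num) h9
    have h93 : Real.log 9 = 2 * Real.log 3 := by
      rw [show (9 : ℝ) = 3 ^ 2 by norm_num, Real.log_pow]; norm_num
    linarith
  have hKR : (K : ℝ) ≤ (Nat.card {N : ℕ | N ≤ X ∧ N ∈ cuspHits 1 goldenJet goldenGerm} : ℝ) := by
    exact_mod_cast hcard
  -- log X/(2 log 3) ≤ log X/log 3 − 1 < K ≤ card
  have hstep : (1 / (2 * Real.log 3)) * Real.log X ≤ Real.log X / Real.log 3 - 1 := by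
    have hid : Real.log X / Real.log 3 - 1 - (1 / (2 * Real.log 3)) * Real.log X
        = (Real.log X - 2 * Real.log 3) / (2 * Real.log 3) := by
      field_simp
      ring
    have hnn : 0 ≤ (Real.log X - 2 * Real.log 3) / (2 * Real.log 3) :=
      div_nonneg (by linarith) (by positivity)
    linarith
  have hK' : Real.log X / Real.log 3 - 1 < K := by
    rw [sub_lt_iff_lt_add, div_lt_iff₀ hlog3]
    linarith
  linarith

/-- **Zero lower log-density fails for the (algebraic) golden tail**: with `e = 1`, `A = φ·X`,
`g = goldenGerm` it is NOT true that for every `ε > 0` the count `#{N ≤ X hit}` is `≤ ε log X` for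
infinitely many `X`. Hence any "cusp hits have zero lower logarithmic density" theorem must use the
transcendence of the tail, even for irrational real jets with non-zero tail, and its `log X` scale is
attained by algebraic tails. [folklore] -/
theorem not_zeroLogDensity_goldenGerm :
    ¬ ∀ ε : ℝ, 0 < ε → ∃ᶠ X : ℕ in atTop,
      (Nat.card {N : ℕ | N ≤ X ∧ ∃ L : ℤ, goldenJet.eval ((((N : ℝ) ^ (((1 : ℕ) : ℝ)⁻¹) : ℝ) : ℂ)) +
        goldenGerm ((((N : ℝ) ^ (((1 : ℕ) : ℝ)⁻¹) : ℝ) : ℂ))⁻¹ = L} : ℝ) ≤ ε * Real.log X := by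
  intro h
  have hlog3 : 0 < Real.log 3 := Real.log_pos (by norm_num)
  have hε : (0 : ℝ) < 1 / (2 * Real.log 3) := by positivity
  have hfreq := h _ hε
  have hev := eventually_log_lt_card_goldenHits
  have : ∃ᶠ X : ℕ in atTop, False := by
    refine (hfreq.and_eventually hev).mono fun X hX => ?_
    obtain ⟨h1, h2⟩ := hX
    have h2' : (1 / (2 * Real.log 3)) * Real.log X <
        (Nat.card {N : ℕ | N ≤ X ∧ ∃ L : ℤ, goldenJet.eval ((((N : ℝ) ^ (((1 : ℕ) : ℝ)⁻¹) : ℝ) : ℂ)) +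
          goldenGerm ((((N : ℝ) ^ (((1 : ℕ) : ℝ)⁻¹) : ℝ) : ℂ))⁻¹ = L} : ℝ) := h2
    linarith
  exact Filter.frequently_false _ this

end

end Literature.NumberTheory.Transcendental
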